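import Summits.BirchSwinnertonDyer.BirchSwinnertonDyer.Theorems.ManinLocalTwoThreePShiftEigenAllLevels
import Summits.BirchSwinnertonDyer.BirchSwinnertonDyer.Theorems.ManinLocalTwoThreeThreeShiftEqualiserAllLevels
import HarnessLib

/-!
# The shift-eigen law for EVERY prime and the `p²`-shift law for every ODD prime (assembly by name)
# (route `ManinLocalTwoThree`, cell bsd-f2-manin; cruxes C2 stmt-BirchSwinnertonDyer-22967 / C3 stmt-…-22968; LEAD seat p1 gen 12)

* **`primeShiftEigenTrivial_all`**: for EVERY prime `p`, every `ε ∈ ℤ/p ∖ {0,1}` and every `N ≥ 1`, an additive `φ : Γ₀(N) → ℤ/p` with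
  `φ(a, pb; c, d) = ε·φ(a, b; pc, d)` on `Γ₀(pN)` vanishes.  `p = 2`: vacuous (`ℤ/2 = {0,1}`); `p = 3`: `ε = −1`, the seat's g11
  `threeShiftAntiInvariantTrivialAt_all` (es's E-es-95/E-es-106 chain); `p ≥ 5`: `PShiftEngine.shiftEigenTrivialAtP_all`.
* **`oddPrimeSqShiftInvariantIsDiamond_all`**: for every ODD prime `p` and every `N ≥ 1`, every additive `φ : Γ₀(N) → ℤ/p` invariant under
  the `p²`-shift is a diamond class.  `p = 3`: the seat's g11 `nineShiftInvariantIsDiamondAt_all` (es's E-es-94♯); `p ≥ 5`: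
  `PShiftEngine.sqShiftInvariantIsDiamondAt_all`.  (At `p = 2` the defect argument degenerates, `−1 = 1`; no claim.)
Nothing about BSD, Manin's conjecture or C2/C3 is proved here (structure theorems about `Γ₀(N)`).
[cite: DarmonDiamondTaylor1995, Lemma 4.28 (p. 135) (shape only)]
-/

set_option autoImplicit false
set_option linter.dupNamespace false

open scoped MatrixGroups

open CongruenceSubgroup Matrix.SpecialLinearGroup
  Summit.BirchSwinnertonDyer.Rank1Residual.ManinAdditive.NineShiftEqualiser

namespace Summit.BirchSwinnertonDyer.BirchSwinnertonDyer.Theorems.ManinLocalTwoThree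

open ThreeShiftDescent TwoShift PShiftTransfer
open Summit.BirchSwinnertonDyer.Rank1Residual.ManinAdditive

/-- At `p = 3`, `ε = 2 = −1`: the `g0Of`-eigen predicate is es's anti-invariance. [folklore] -/
theorem isThreeShiftAntiInvariant_of_isShiftEigenP_two {N : ℕ} (φ : Gamma0 N → ZMod 3) (h : IsShiftEigenP 3 (2 : ZMod 3) φ) :
    IsThreeShiftAntiInvariant φ := by
  have e2 : ∀ x : ZMod 3, 2 * x = -x := by decide
  intro a b c d hdet hc
  have := h a b c d hdet hc
  rw [e2] at this
  exact this

/-- **THE SHIFT-EIGEN LAW FOR EVERY PRIME**: `K^ε_p(N) = 0` for every prime `p`, every `ε ≠ 0, 1` in `ℤ/p`, every `N ≥ 1`. [new: assembly] -/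
theorem primeShiftEigenTrivial_all (p : ℕ) [Fact p.Prime] (ε : ZMod p) (hε0 : ε ≠ 0) (hε1 : ε ≠ 1) (N : ℕ) (hN : 0 < N) :
    ShiftEigenTrivialAtP p N ε := by
  have hp : p.Prime := Fact.out
  by_cases h5 : 5 ≤ p
  · exact PShiftEngine.shiftEigenTrivialAtP_all h5 hε0 hε1 N hN
  · have h2 := hp.two_le
    interval_cases p
    · -- `p = 2`: no `ε ∉ {0,1}`
      exfalso
      fin_cases ε
      · exact hε0 rfl
      · exact hε1 rfl
    · -- `p = 3`: `ε = −1`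
      fin_cases ε
      · exact absurd rfl hε0
      · exact absurd rfl hε1
      · intro φ hadd hinv γ
        exact threeShiftAntiInvariantTrivialAt_all N hN φ hadd (isThreeShiftAntiInvariant_of_isShiftEigenP_two φ hinv) γ
    · exact absurd hp (by decide)

/-- **THE `p²`-SHIFT LAW FOR EVERY ODD PRIME**: for `p` an odd prime and `N ≥ 1`, every additive `p²`-shift-invariant `φ : Γ₀(N) → ℤ/p` is a
diamond class. [new: assembly] -/
theorem oddPrimeSqShiftInvariantIsDiamond_all (p : ℕ) [Fact p.Prime] (hp2 : p ≠ 2) (N : ℕ) (hN : 0 < N) :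
    ShiftEqualiser.ShiftInvariantIsDiamondAt (ZMod p) ((p ^ 2 : ℕ) : ℤ) N := by
  have hp : p.Prime := Fact.out
  by_cases h5 : 5 ≤ p
  · exact PShiftEngine.sqShiftInvariantIsDiamondAt_all h5 N hN
  · have h2 := hp.two_le
    interval_cases p
    · exact absurd rfl hp2
    · intro φ hadd hinv
      have e : (((3 ^ 2 : ℕ)) : ℤ) = 9 := by norm_num
      rw [e] at hinv
      exact (ShiftEqualiser.isDiamondChar_iff φ).mp
        (nineShiftInvariantIsDiamondAt_all N φ ((ShiftEqualiser.isAddChar_iff φ).mpr hadd)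
          ((ShiftEqualiser.isNineShiftInvariant_iff φ).mpr hinv))
    · exact absurd hp (by decide)

end Summit.BirchSwinnertonDyer.BirchSwinnertonDyer.Theorems.ManinLocalTwoThree
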